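import Summits.AtomisticToContinuum.FouriersLaw.Theorems.HonestZwanzigRobinCoercivityStubBlockForm
import Summits.AtomisticToContinuum.FouriersLaw.Theorems.HonestZwanzigRobinCoercivityCornerOfCruxAux

/-!
# `HonestZwanzig.RobinCoercivity` — corner coercivity (Q2) from the crux plus a flux-row bound

Support file (`--supports` the crux `RobinCoercivity`, stmt-AtomisticToContinuum-12695, of route `HonestZwanzig`,
sub-problem `FouriersLaw`; LINK lemma `cornerCoercivity_of_robinCoercivity` of line `limit-operator-memory-form`,
skeleton `Cruxes/RobinCoercivity/Lines/limit_operator_memory_form.lean`; linear algebra in `…CornerOfCruxAux`).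

The line's open stub (Q2) `stub_cornerCoercivity` (corner sections of the block memory matrix `W_N(s)` on bond ⊕
contact positions `Fin (N+1)` are coercive, uniformly in `N`, for every fixed window size `w`) FOLLOWS from the crux
`RobinCoercivity` itself together with an `N`-uniform bound `|(W_N(s)u)_i| ≤ C` on the flux rows of `W_N(s)`
(`u = (1, …, 1, −1)` the flux direction; this bound is `OrthogonalOhm`-class data). So (Q2) is "crux + rank-2 data".

Proof (everything at one fixed `N`, one fixed `s`, over the landed block form `stub_blockForm`):
* `Ran B = u^⊥` (`corner_partialSum_Bv`): a vector `y ⊥ u` is `Bξ` for the partial-sum profile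
  `ξ_x = Σ_{i ≤ x} y_i`, with `|ξ|² ≤ N(N+1)|y|²`;
* hence by the crux and the block form `yᵀW(s)y = ξᵀ𝔽(s)ξ − s·ξᵀCov(e,e)ξ ≥ c|y|² − sΛN(N+1)|y|² ≥ (c/2)|y|²`
  for `s` small (`corner_fixedN`), `Λ = 1 + Σ_{x,y}|Cov(e_x,e_y)|`;
* a corner vector `v` with at most `w` nonzero entries splits as `v = y + αu`, `y ⊥ u`, `α = ⟨v,u⟩/(N+1)`, and
  `vᵀWv = yᵀWy + 2α(Wu)ᵀy + α²uᵀWu ≥ (c/2)(1 − w/(N+1))|v|² − 5Cw|v|²/(N+1) ≥ (c/4)|v|²` once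
  `(N+1)c ≥ 2wc + 20Cw` (`corner_bound_abstract`, `corner_threshold`);
* the quantifier order `∃ s₀ ∀ gadgets` is harmless because the defining equations determine the gadgets
  (`corner_largeN`).
-/

noncomputable section

open MeasureTheory Finset Matrix Filter Topology
open Literature.MathematicalPhysics.KineticTheory.HeatConduction
open Summit.AtomisticToContinuum.FouriersLaw.Theses.HonestZwanzig

namespace Summit.AtomisticToContinuum.FouriersLaw.Theorems.HonestZwanzig.Robin

/-! ### Fixed `N`, fixed `s`: the chain step over the block form -/

section FixedN

variable {ω₂ lam β γ T : ℝ} {N : ℕ}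

/-- **Corner coercivity at fixed `(N, s)` over abstract gadgets.** From the block form (`stub_blockForm`), Robin
coercivity of `𝔽_N(s)` with constant `c` (the crux at this `(N, s)`), the bound `ξᵀCov(e,e)ξ ≤ Λ|ξ|²` with
`sΛN(N+1) ≤ c/4`, the flux-row bound `|(W_N(s)u)_i| ≤ C` and the threshold `(N+1)c ≥ 2wc + 20Cw`: both corner clauses
of (Q2) with constant `c/4`. The chain enters only through `stub_blockForm`; `u^⊥ = Ran B` by `corner_partialSum_Bv`. -/
theorem corner_fixedN (hω : 0 < ω₂) (hl : 0 < lam) (hβ : 0 < β) (hγ : 0 < γ) (hT : 0 < T) (hN : 2 ≤ N)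
    (c C Λ : ℝ) (hc : 0 < c) (hΛ0 : 0 ≤ Λ) (w : ℕ) (hNw : 2 * (w : ℝ) * c + 20 * C * w ≤ ((N : ℝ) + 1) * c)
    (lap : ℝ → (PhaseSpace N → ℝ) → (PhaseSpace N → ℝ) → ℝ)
    (cov : (PhaseSpace N → ℝ) → (PhaseSpace N → ℝ) → ℝ) (e : Fin N → PhaseSpace N → ℝ)
    (G : ℝ → Matrix (Fin N) (Fin N) ℝ) (schur : ℝ → (PhaseSpace N → ℝ) → (PhaseSpace N → ℝ) → ℝ)
    (F : ℝ → Fin N → Fin N → ℝ) (g : Fin (N + 1) → PhaseSpace N → ℝ)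
    (W : ℝ → Fin (N + 1) → Fin (N + 1) → ℝ) (Bv : (Fin N → ℝ) → Fin (N + 1) → ℝ)
    (hlap : ∀ s f₁ f₂, lap s f₁ f₂ = ∫ t in Set.Ioi (0 : ℝ), Real.exp (-(s * t)) *
      ((∫ z, f₁ z * (∫ y, f₂ y ∂((pinnedChain ω₂ lam β γ).transitionKernel N T T t.toNNReal z))
          ∂(pinnedChain ω₂ lam β γ).gibbsMeasure N T) -
        (∫ z, f₁ z ∂(pinnedChain ω₂ lam β γ).gibbsMeasure N T) *
          (∫ z, f₂ z ∂(pinnedChain ω₂ lam β γ).gibbsMeasure N T)))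
    (hcov : ∀ f₁ f₂, cov f₁ f₂ = (∫ z, f₁ z * f₂ z ∂(pinnedChain ω₂ lam β γ).gibbsMeasure N T) -
      (∫ z, f₁ z ∂(pinnedChain ω₂ lam β γ).gibbsMeasure N T) *
        (∫ z, f₂ z ∂(pinnedChain ω₂ lam β γ).gibbsMeasure N T))
    (he : ∀ x z, e x z = z.2 x ^ 2 / 2 + (pinnedChain ω₂ lam β γ).U (z.1 x) +
      ∑ j : Fin N, ((if j.val = x.val + 1 then (pinnedChain ω₂ lam β γ).V (z.1 j - z.1 x) / 2 else 0) +
        (if x.val = j.val + 1 then (pinnedChain ω₂ lam β γ).V (z.1 x - z.1 j) / 2 else 0)))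
    (hG : ∀ s, G s = Matrix.of fun x y => lap s (e x) (e y))
    (hschur : ∀ s f₁ f₂, schur s f₁ f₂ = lap s f₁ f₂ - ∑ x, ∑ y, lap s f₁ (e x) * (G s)⁻¹ x y * lap s (e y) f₂)
    (hF : ∀ s x y, F s x y = s * cov (e x) (e y) - cov (e x) ((pinnedChain ω₂ lam β γ).generator N T T (e y)) -
      schur s (fun z => (pinnedChain ω₂ lam β γ).generator N T T (e x) (z.1, -z.2))
        ((pinnedChain ω₂ lam β γ).generator N T T (e y)))
    (hg : ∀ i z, g i z = (∑ b : Fin N, if b.val + 1 = i.val then (pinnedChain ω₂ lam β γ).bondCurrent N b z else 0) +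
      (∑ x : Fin N, if (i.val = 0 ∧ x.val = 0) ∨ (i.val = N ∧ x.val + 1 = N) then
        (pinnedChain ω₂ lam β γ).γ * (T - z.2 x ^ 2) else 0))
    (hW : ∀ s i j, W s i j = (if i = j ∧ (i.val = 0 ∨ i.val = N) then (pinnedChain ω₂ lam β γ).γ * T ^ 2 else 0) -
      schur s (fun z => g i (z.1, -z.2)) (g j))
    (hBv : ∀ ξ i, Bv ξ i = if i.val = N then (∑ x : Fin N, if x.val + 1 = N then ξ x else 0)
      else ∑ x : Fin N, ((if x.val = i.val then ξ x else 0) - (if x.val + 1 = i.val then ξ x else 0)))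
    {s : ℝ} (hs : 0 < s) (hsΛ : s * (Λ * ((N : ℝ) * ((N : ℝ) + 1))) ≤ c / 4)
    (hΛ : ∀ ξ : Fin N → ℝ, ∑ x, ∑ y, ξ x * cov (e x) (e y) * ξ y ≤ Λ * ∑ x, ξ x ^ 2)
    (hRobin : ∀ ξ : Fin N → ℝ, c * (∑ i : Fin N, ((∑ j : Fin N,
        if j.val = i.val + 1 then (ξ j - ξ i) ^ 2 else 0) + (if i.val = 0 then ξ i ^ 2 else 0) +
        (if i.val = N - 1 then ξ i ^ 2 else 0))) ≤ ∑ x, ∑ y, ξ x * F s x y * ξ y)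
    (hfl : ∀ i : Fin (N + 1), |∑ j : Fin (N + 1), W s i j * (if j.val = N then -1 else 1)| ≤ C) :
    (∀ v : Fin (N + 1) → ℝ, (∀ i : Fin (N + 1), w ≤ i.val → v i = 0) →
        c / 4 * ∑ i, v i ^ 2 ≤ ∑ i, ∑ j, v i * W s i j * v j) ∧
      (∀ v : Fin (N + 1) → ℝ, (∀ i : Fin (N + 1), i.val + w < N + 1 → v i = 0) →
        c / 4 * ∑ i, v i ^ 2 ≤ ∑ i, ∑ j, v i * W s i j * v j) := by
  classical
  have hN1 : 1 ≤ N := by omega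
  obtain ⟨hsym, -, hid, hrob⟩ := stub_blockForm ω₂ lam β γ hω hl hβ hγ T hT N hN lap cov e G schur F g W Bv
    hlap hcov he hG hschur hF hg hW hBv s hs
  -- coercivity of `W_N(s)` on `u^⊥ = Ran B`, from the crux through the block form
  have hcoer : ∀ y : Fin (N + 1) → ℝ, ∑ j, y j * (if j.val = N then -1 else 1) = 0 →
      c / 2 * ∑ j, y j ^ 2 ≤ ∑ i, ∑ j, y i * W s i j * y j := by
    intro y hy
    obtain ⟨ξ, hξ, hξn⟩ := corner_partialSum_Bv hN1 Bv hBv y hy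
    have h1 : ∑ i, ∑ j, y i * W s i j * y j = ∑ i, ∑ j, Bv ξ i * W s i j * Bv ξ j := by simp only [hξ]
    have h2 : ∑ i, Bv ξ i ^ 2 = ∑ i, y i ^ 2 := by simp only [hξ]
    have h3 := hid ξ
    have h4 := hRobin ξ
    rw [← hrob ξ, h2] at h4
    have hV0 : 0 ≤ ∑ i, y i ^ 2 := Finset.sum_nonneg fun i _ => sq_nonneg _
    have h6 : s * (∑ x, ∑ y, ξ x * cov (e x) (e y) * ξ y) ≤ c / 4 * ∑ i, y i ^ 2 :=
      calc s * (∑ x, ∑ y, ξ x * cov (e x) (e y) * ξ y) ≤ s * (Λ * ∑ x, ξ x ^ 2) :=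
            mul_le_mul_of_nonneg_left (hΛ ξ) hs.le
        _ ≤ s * (Λ * (((N : ℝ) * ((N : ℝ) + 1)) * ∑ i, y i ^ 2)) :=
            mul_le_mul_of_nonneg_left (mul_le_mul_of_nonneg_left hξn hΛ0) hs.le
        _ = (s * (Λ * ((N : ℝ) * ((N : ℝ) + 1)))) * ∑ i, y i ^ 2 := by ring
        _ ≤ c / 4 * ∑ i, y i ^ 2 := mul_le_mul_of_nonneg_right hsΛ hV0
    have hcV : 0 ≤ c * ∑ i, y i ^ 2 := mul_nonneg hc.le hV0
    rw [h1]
    linarith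
  have hu : ∀ j : Fin (N + 1), (if j.val = N then (-1 : ℝ) else 1) = 1 ∨ (if j.val = N then (-1 : ℝ) else 1) = -1 :=
    fun j => by split_ifs <;> simp
  have hNw' : 2 * (w : ℝ) * c + 20 * C * w ≤ ((N + 1 : ℕ) : ℝ) * c := by
    push_cast
    exact hNw
  refine ⟨fun v hv => ?_, fun v hv => ?_⟩
  · refine corner_bound_abstract (Nat.succ_pos N) (W s) hsym _ hu c C hc w hfl hcoer hNw' v
      (Finset.univ.filter fun i : Fin (N + 1) => i.val < w) ?_ ?_
    · calc (Finset.univ.filter fun i : Fin (N + 1) => i.val < w).card ≤ (Finset.range w).card := by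
            refine Finset.card_le_card_of_injOn (fun i => i.val) ?_ ?_
            · intro i hi
              simp only [Finset.coe_filter, Finset.mem_univ, true_and, Set.mem_setOf_eq] at hi
              simpa using hi
            · intro i _ j _ h
              exact Fin.ext h
        _ = w := Finset.card_range w
    · intro i hi
      apply hv
      simp only [Finset.mem_filter, Finset.mem_univ, true_and, not_lt] at hi
      exact hi
  · refine corner_bound_abstract (Nat.succ_pos N) (W s) hsym _ hu c C hc w hfl hcoer hNw' v
      (Finset.univ.filter fun i : Fin (N + 1) => N + 1 ≤ i.val + w) ?_ ?_
    · calc (Finset.univ.filter fun i : Fin (N + 1) => N + 1 ≤ i.val + w).card ≤ (Finset.range w).card := by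
            refine Finset.card_le_card_of_injOn (fun i => N - i.val) ?_ ?_
            · intro i hi
              simp only [Finset.coe_filter, Finset.mem_univ, true_and, Set.mem_setOf_eq] at hi
              have := i.isLt
              simp only [Finset.coe_range, Set.mem_Iio]
              omega
            · intro i _ j _ h
              have := i.isLt
              have := j.isLt
              exact Fin.ext (by simp only at h; omega)
        _ = w := Finset.card_range w
    · intro i hi
      apply hv
      simp only [Finset.mem_filter, Finset.mem_univ, true_and, not_le] at hi
      omega

/-- **Large `N`: the quantifier bookkeeping.** Given the crux's clause at this `N` (`hR`, over the gadgets) and the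
flux-row bound (`hf`), choose `s₀ = min(s₀ᴿ, s₀ᶠ, c/(4ΛN(N+1)))` with `Λ = 1 + Σ_{x,y}|Cov(e_x,e_y)|`; any gadgets
with the defining equations coincide with the given ones, and `corner_fixedN` applies. -/
theorem corner_largeN (hω : 0 < ω₂) (hl : 0 < lam) (hβ : 0 < β) (hγ : 0 < γ) (hT : 0 < T) (hN : 2 ≤ N)
    (c C : ℝ) (hc : 0 < c) (w : ℕ) (hNw : 2 * (w : ℝ) * c + 20 * C * w ≤ ((N : ℝ) + 1) * c)
    (s₀R s₀f : ℝ) (hs₀R : 0 < s₀R) (hs₀f : 0 < s₀f)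
    (lap : ℝ → (PhaseSpace N → ℝ) → (PhaseSpace N → ℝ) → ℝ)
    (cov : (PhaseSpace N → ℝ) → (PhaseSpace N → ℝ) → ℝ) (e : Fin N → PhaseSpace N → ℝ)
    (G : ℝ → Matrix (Fin N) (Fin N) ℝ) (schur : ℝ → (PhaseSpace N → ℝ) → (PhaseSpace N → ℝ) → ℝ)
    (F : ℝ → Fin N → Fin N → ℝ) (g : Fin (N + 1) → PhaseSpace N → ℝ)
    (W : ℝ → Fin (N + 1) → Fin (N + 1) → ℝ)
    (hlap : ∀ s f₁ f₂, lap s f₁ f₂ = ∫ t in Set.Ioi (0 : ℝ), Real.exp (-(s * t)) *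
      ((∫ z, f₁ z * (∫ y, f₂ y ∂((pinnedChain ω₂ lam β γ).transitionKernel N T T t.toNNReal z))
          ∂(pinnedChain ω₂ lam β γ).gibbsMeasure N T) -
        (∫ z, f₁ z ∂(pinnedChain ω₂ lam β γ).gibbsMeasure N T) *
          (∫ z, f₂ z ∂(pinnedChain ω₂ lam β γ).gibbsMeasure N T)))
    (hcov : ∀ f₁ f₂, cov f₁ f₂ = (∫ z, f₁ z * f₂ z ∂(pinnedChain ω₂ lam β γ).gibbsMeasure N T) -
      (∫ z, f₁ z ∂(pinnedChain ω₂ lam β γ).gibbsMeasure N T) *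
        (∫ z, f₂ z ∂(pinnedChain ω₂ lam β γ).gibbsMeasure N T))
    (he : ∀ x z, e x z = z.2 x ^ 2 / 2 + (pinnedChain ω₂ lam β γ).U (z.1 x) +
      ∑ j : Fin N, ((if j.val = x.val + 1 then (pinnedChain ω₂ lam β γ).V (z.1 j - z.1 x) / 2 else 0) +
        (if x.val = j.val + 1 then (pinnedChain ω₂ lam β γ).V (z.1 x - z.1 j) / 2 else 0)))
    (hG : ∀ s, G s = Matrix.of fun x y => lap s (e x) (e y))
    (hschur : ∀ s f₁ f₂, schur s f₁ f₂ = lap s f₁ f₂ - ∑ x, ∑ y, lap s f₁ (e x) * (G s)⁻¹ x y * lap s (e y) f₂)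
    (hF : ∀ s x y, F s x y = s * cov (e x) (e y) - cov (e x) ((pinnedChain ω₂ lam β γ).generator N T T (e y)) -
      schur s (fun z => (pinnedChain ω₂ lam β γ).generator N T T (e x) (z.1, -z.2))
        ((pinnedChain ω₂ lam β γ).generator N T T (e y)))
    (hg : ∀ i z, g i z = (∑ b : Fin N, if b.val + 1 = i.val then (pinnedChain ω₂ lam β γ).bondCurrent N b z else 0) +
      (∑ x : Fin N, if (i.val = 0 ∧ x.val = 0) ∨ (i.val = N ∧ x.val + 1 = N) then
        (pinnedChain ω₂ lam β γ).γ * (T - z.2 x ^ 2) else 0))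
    (hW : ∀ s i j, W s i j = (if i = j ∧ (i.val = 0 ∨ i.val = N) then (pinnedChain ω₂ lam β γ).γ * T ^ 2 else 0) -
      schur s (fun z => g i (z.1, -z.2)) (g j))
    (hR : ∀ s : ℝ, 0 < s → s < s₀R → ∀ ξ : Fin N → ℝ, c * (∑ i : Fin N, ((∑ j : Fin N,
        if j.val = i.val + 1 then (ξ j - ξ i) ^ 2 else 0) + (if i.val = 0 then ξ i ^ 2 else 0) +
        (if i.val = N - 1 then ξ i ^ 2 else 0))) ≤ ∑ x, ∑ y, ξ x * F s x y * ξ y)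
    (hf : ∀ s : ℝ, 0 < s → s < s₀f →
      ∀ i : Fin (N + 1), |∑ j : Fin (N + 1), W s i j * (if j.val = N then -1 else 1)| ≤ C) :
    ∃ s₀ : ℝ, 0 < s₀ ∧
    ∀ (lap : ℝ → (PhaseSpace N → ℝ) → (PhaseSpace N → ℝ) → ℝ) (e : Fin N → PhaseSpace N → ℝ)
      (G : ℝ → Matrix (Fin N) (Fin N) ℝ) (schur : ℝ → (PhaseSpace N → ℝ) → (PhaseSpace N → ℝ) → ℝ)
      (g : Fin (N + 1) → PhaseSpace N → ℝ) (W : ℝ → Fin (N + 1) → Fin (N + 1) → ℝ),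
    (∀ s f₁ f₂, lap s f₁ f₂ = ∫ t in Set.Ioi (0 : ℝ), Real.exp (-(s * t)) *
      ((∫ z, f₁ z * (∫ y, f₂ y ∂((pinnedChain ω₂ lam β γ).transitionKernel N T T t.toNNReal z))
          ∂(pinnedChain ω₂ lam β γ).gibbsMeasure N T) -
        (∫ z, f₁ z ∂(pinnedChain ω₂ lam β γ).gibbsMeasure N T) *
          (∫ z, f₂ z ∂(pinnedChain ω₂ lam β γ).gibbsMeasure N T))) →
    (∀ x z, e x z = z.2 x ^ 2 / 2 + (pinnedChain ω₂ lam β γ).U (z.1 x) +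
      ∑ j : Fin N, ((if j.val = x.val + 1 then (pinnedChain ω₂ lam β γ).V (z.1 j - z.1 x) / 2 else 0) +
        (if x.val = j.val + 1 then (pinnedChain ω₂ lam β γ).V (z.1 x - z.1 j) / 2 else 0))) →
    (∀ s, G s = Matrix.of fun x y => lap s (e x) (e y)) →
    (∀ s f₁ f₂, schur s f₁ f₂ = lap s f₁ f₂ - ∑ x, ∑ y, lap s f₁ (e x) * (G s)⁻¹ x y * lap s (e y) f₂) →
    (∀ i z, g i z = (∑ b : Fin N, if b.val + 1 = i.val then (pinnedChain ω₂ lam β γ).bondCurrent N b z else 0) +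
      (∑ x : Fin N, if (i.val = 0 ∧ x.val = 0) ∨ (i.val = N ∧ x.val + 1 = N) then
        (pinnedChain ω₂ lam β γ).γ * (T - z.2 x ^ 2) else 0)) →
    (∀ s i j, W s i j = (if i = j ∧ (i.val = 0 ∨ i.val = N) then (pinnedChain ω₂ lam β γ).γ * T ^ 2 else 0) -
      schur s (fun z => g i (z.1, -z.2)) (g j)) →
    ∀ s : ℝ, 0 < s → s < s₀ →
      (∀ v : Fin (N + 1) → ℝ, (∀ i : Fin (N + 1), w ≤ i.val → v i = 0) →
        c / 4 * ∑ i, v i ^ 2 ≤ ∑ i, ∑ j, v i * W s i j * v j) ∧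
      (∀ v : Fin (N + 1) → ℝ, (∀ i : Fin (N + 1), i.val + w < N + 1 → v i = 0) →
        c / 4 * ∑ i, v i ^ 2 ≤ ∑ i, ∑ j, v i * W s i j * v j) := by
  obtain ⟨Bv, hBv⟩ : ∃ Bv : (Fin N → ℝ) → Fin (N + 1) → ℝ, ∀ ξ i, Bv ξ i =
      if i.val = N then (∑ x : Fin N, if x.val + 1 = N then ξ x else 0)
      else ∑ x : Fin N, ((if x.val = i.val then ξ x else 0) - (if x.val + 1 = i.val then ξ x else 0)) :=
    ⟨_, fun _ _ => rfl⟩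
  obtain ⟨L, hL⟩ : ∃ L : ℝ, L = ∑ x, ∑ y, |cov (e x) (e y)| := ⟨_, rfl⟩
  have hL0 : 0 ≤ L := hL ▸ Finset.sum_nonneg fun _ _ => Finset.sum_nonneg fun _ _ => abs_nonneg _
  have hΛ : ∀ ξ : Fin N → ℝ, ∑ x, ∑ y, ξ x * cov (e x) (e y) * ξ y ≤ (L + 1) * ∑ x, ξ x ^ 2 := fun ξ => by
    have h1 := corner_quad_le (fun x y => cov (e x) (e y)) ξ
    rw [← hL] at h1
    have hV0 : 0 ≤ ∑ x, ξ x ^ 2 := Finset.sum_nonneg fun i _ => sq_nonneg _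
    nlinarith
  have hNN : (0 : ℝ) < (N : ℝ) * ((N : ℝ) + 1) := by positivity
  have hD : 0 < (L + 1) * ((N : ℝ) * ((N : ℝ) + 1)) := mul_pos (by linarith) hNN
  refine ⟨min (min s₀R s₀f) (c / 4 / ((L + 1) * ((N : ℝ) * ((N : ℝ) + 1)))),
    lt_min (lt_min hs₀R hs₀f) (div_pos (by linarith) hD), ?_⟩
  intro lap' e' G' schur' g' W' hlap' he' hG' hschur' hg' hW' s hs hss
  obtain rfl : lap = lap' :=
    funext fun s => funext fun f₁ => funext fun f₂ => (hlap s f₁ f₂).trans (hlap' s f₁ f₂).symm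
  obtain rfl : e = e' := funext fun x => funext fun z => (he x z).trans (he' x z).symm
  obtain rfl : G = G' := funext fun s => (hG s).trans (hG' s).symm
  obtain rfl : schur = schur' :=
    funext fun s => funext fun f₁ => funext fun f₂ => (hschur s f₁ f₂).trans (hschur' s f₁ f₂).symm
  obtain rfl : g = g' := funext fun i => funext fun z => (hg i z).trans (hg' i z).symm
  obtain rfl : W = W' := funext fun s => funext fun i => funext fun j => (hW s i j).trans (hW' s i j).symm
  have hsR : s < s₀R := lt_of_lt_of_le hss ((min_le_left _ _).trans (min_le_left _ _))
  have hsf : s < s₀f := lt_of_lt_of_le hss ((min_le_left _ _).trans (min_le_right _ _))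
  have hsΛ : s * ((L + 1) * ((N : ℝ) * ((N : ℝ) + 1))) ≤ c / 4 :=
    ((lt_div_iff₀ hD).mp (lt_of_lt_of_le hss (min_le_right _ _))).le
  exact corner_fixedN hω hl hβ hγ hT hN c C (L + 1) hc (by linarith) w hNw lap cov e G schur F g W Bv
    hlap hcov he hG hschur hF hg hW hBv hs hsΛ hΛ (hR s hs hsR) (hf s hs hsf)

end FixedN

/-! ### The link lemma -/

/-- **LINK LEMMA (registered, line `limit-operator-memory-form`): corner coercivity (Q2) follows from the crux
`RobinCoercivity` plus an `N`-uniform bound on the flux rows of the block memory matrix.** Hypotheses: `hRC` — the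
crux itself; `hflux` — for every `N ≥ 2` and small `s > 0`, every flux row `(W_N(s)u)_i = Σ_j W_N(s)_{ij} u_j`
(`u_j = 1` at `j < N`, `u_N = −1`) has modulus `≤ C`, `C` independent of `N` (`OrthogonalOhm`-class data). Conclusion:
verbatim the open stub `stub_cornerCoercivity` (= `Robin.CornerCoercivity`), with `m = c/4` and
`N₁(w) ≈ (2c + 20C)w/c`. Proof: `Ran B = u^⊥` (`corner_partialSum_Bv`), so by the block form (`stub_blockForm`) the
crux gives `yᵀW_N(s)y ≥ (c/2)|y|²` on `u^⊥` for `s` small (`corner_fixedN`); a corner vector with `≤ w` nonzero entries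
is `y + αu` with `|α| ≤ √w|v|/(N+1)`, and the flux-row bound controls the cross and `uᵀWu` terms by `5Cw|v|²/(N+1)`
(`corner_bound_abstract`). -/
theorem cornerCoercivity_of_robinCoercivity (hRC : RobinCoercivity)
    (hflux : ∀ ω₂ lam β γ : ℝ, 0 < ω₂ → 0 < lam → 0 < β → 0 < γ → ∀ T : ℝ, 0 < T →
      ∃ C : ℝ, ∀ N : ℕ, 2 ≤ N → ∃ s₀ : ℝ, 0 < s₀ ∧
      ∀ (lap : ℝ → (PhaseSpace N → ℝ) → (PhaseSpace N → ℝ) → ℝ) (e : Fin N → PhaseSpace N → ℝ)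
        (G : ℝ → Matrix (Fin N) (Fin N) ℝ) (schur : ℝ → (PhaseSpace N → ℝ) → (PhaseSpace N → ℝ) → ℝ)
        (g : Fin (N + 1) → PhaseSpace N → ℝ) (W : ℝ → Fin (N + 1) → Fin (N + 1) → ℝ),
      (∀ s f₁ f₂, lap s f₁ f₂ = ∫ t in Set.Ioi (0 : ℝ), Real.exp (-(s * t)) *
        ((∫ z, f₁ z * (∫ y, f₂ y ∂((pinnedChain ω₂ lam β γ).transitionKernel N T T t.toNNReal z))
            ∂(pinnedChain ω₂ lam β γ).gibbsMeasure N T) -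
          (∫ z, f₁ z ∂(pinnedChain ω₂ lam β γ).gibbsMeasure N T) *
            (∫ z, f₂ z ∂(pinnedChain ω₂ lam β γ).gibbsMeasure N T))) →
      (∀ x z, e x z = z.2 x ^ 2 / 2 + (pinnedChain ω₂ lam β γ).U (z.1 x) +
        ∑ j : Fin N, ((if j.val = x.val + 1 then (pinnedChain ω₂ lam β γ).V (z.1 j - z.1 x) / 2 else 0) +
          (if x.val = j.val + 1 then (pinnedChain ω₂ lam β γ).V (z.1 x - z.1 j) / 2 else 0))) →
      (∀ s, G s = Matrix.of fun x y => lap s (e x) (e y)) →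
      (∀ s f₁ f₂, schur s f₁ f₂ = lap s f₁ f₂ - ∑ x, ∑ y, lap s f₁ (e x) * (G s)⁻¹ x y * lap s (e y) f₂) →
      (∀ i z, g i z = (∑ b : Fin N, if b.val + 1 = i.val then (pinnedChain ω₂ lam β γ).bondCurrent N b z else 0) +
        (∑ x : Fin N, if (i.val = 0 ∧ x.val = 0) ∨ (i.val = N ∧ x.val + 1 = N) then
          (pinnedChain ω₂ lam β γ).γ * (T - z.2 x ^ 2) else 0)) →
      (∀ s i j, W s i j = (if i = j ∧ (i.val = 0 ∨ i.val = N) then (pinnedChain ω₂ lam β γ).γ * T ^ 2 else 0) -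
        schur s (fun z => g i (z.1, -z.2)) (g j)) →
      ∀ s : ℝ, 0 < s → s < s₀ → ∀ i : Fin (N + 1), |∑ j : Fin (N + 1), W s i j * (if j.val = N then -1 else 1)| ≤ C) :
    ∀ ω₂ lam β γ : ℝ, 0 < ω₂ → 0 < lam → 0 < β → 0 < γ → ∀ T : ℝ, 0 < T →
    ∃ m : ℝ, 0 < m ∧ ∀ w : ℕ, ∃ N₁ : ℕ, ∀ N : ℕ, N₁ ≤ N → 2 ≤ N → ∃ s₀ : ℝ, 0 < s₀ ∧
    ∀ (lap : ℝ → (PhaseSpace N → ℝ) → (PhaseSpace N → ℝ) → ℝ) (e : Fin N → PhaseSpace N → ℝ)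
      (G : ℝ → Matrix (Fin N) (Fin N) ℝ) (schur : ℝ → (PhaseSpace N → ℝ) → (PhaseSpace N → ℝ) → ℝ)
      (g : Fin (N + 1) → PhaseSpace N → ℝ) (W : ℝ → Fin (N + 1) → Fin (N + 1) → ℝ),
    (∀ s f₁ f₂, lap s f₁ f₂ = ∫ t in Set.Ioi (0 : ℝ), Real.exp (-(s * t)) *
      ((∫ z, f₁ z * (∫ y, f₂ y ∂((pinnedChain ω₂ lam β γ).transitionKernel N T T t.toNNReal z))
          ∂(pinnedChain ω₂ lam β γ).gibbsMeasure N T) -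
        (∫ z, f₁ z ∂(pinnedChain ω₂ lam β γ).gibbsMeasure N T) *
          (∫ z, f₂ z ∂(pinnedChain ω₂ lam β γ).gibbsMeasure N T))) →
    (∀ x z, e x z = z.2 x ^ 2 / 2 + (pinnedChain ω₂ lam β γ).U (z.1 x) +
      ∑ j : Fin N, ((if j.val = x.val + 1 then (pinnedChain ω₂ lam β γ).V (z.1 j - z.1 x) / 2 else 0) +
        (if x.val = j.val + 1 then (pinnedChain ω₂ lam β γ).V (z.1 x - z.1 j) / 2 else 0))) →
    (∀ s, G s = Matrix.of fun x y => lap s (e x) (e y)) →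
    (∀ s f₁ f₂, schur s f₁ f₂ = lap s f₁ f₂ - ∑ x, ∑ y, lap s f₁ (e x) * (G s)⁻¹ x y * lap s (e y) f₂) →
    (∀ i z, g i z = (∑ b : Fin N, if b.val + 1 = i.val then (pinnedChain ω₂ lam β γ).bondCurrent N b z else 0) +
      (∑ x : Fin N, if (i.val = 0 ∧ x.val = 0) ∨ (i.val = N ∧ x.val + 1 = N) then
        (pinnedChain ω₂ lam β γ).γ * (T - z.2 x ^ 2) else 0)) →
    (∀ s i j, W s i j = (if i = j ∧ (i.val = 0 ∨ i.val = N) then (pinnedChain ω₂ lam β γ).γ * T ^ 2 else 0) -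
      schur s (fun z => g i (z.1, -z.2)) (g j)) →
    ∀ s : ℝ, 0 < s → s < s₀ →
      (∀ v : Fin (N + 1) → ℝ, (∀ i : Fin (N + 1), w ≤ i.val → v i = 0) →
        m * ∑ i, v i ^ 2 ≤ ∑ i, ∑ j, v i * W s i j * v j) ∧
      (∀ v : Fin (N + 1) → ℝ, (∀ i : Fin (N + 1), i.val + w < N + 1 → v i = 0) →
        m * ∑ i, v i ^ 2 ≤ ∑ i, ∑ j, v i * W s i j * v j) := by
  intro ω₂ lam β γ hω hl hβ hγ T hT
  obtain ⟨c, hc, hcN⟩ := hRC ω₂ lam β γ hω hl hβ hγ T hT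
  obtain ⟨C, hCN⟩ := hflux ω₂ lam β γ hω hl hβ hγ T hT
  refine ⟨c / 4, by positivity, fun w => ?_⟩
  obtain ⟨N₁, hN₁⟩ := corner_threshold c C w hc
  refine ⟨N₁, fun N hNN hN => ?_⟩
  obtain ⟨s₀R, hs₀R, hR⟩ := hcN N hN
  dsimp only at hR
  obtain ⟨s₀f, hs₀f, hf⟩ := hCN N hN
  exact corner_largeN hω hl hβ hγ hT hN c C hc w (hN₁ N hNN) s₀R s₀f hs₀R hs₀f _ _ _ _ _ _ _ _
    (fun _ _ _ => rfl) (fun _ _ => rfl) (fun _ _ => rfl) (fun _ => rfl) (fun _ _ _ => rfl) (fun _ _ _ => rfl)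
    (fun _ _ => rfl) (fun _ _ _ => rfl) hR
    (hf _ _ _ _ _ _ (fun _ _ _ => rfl) (fun _ _ => rfl) (fun _ => rfl) (fun _ _ _ => rfl) (fun _ _ => rfl)
      (fun _ _ _ => rfl))

end Summit.AtomisticToContinuum.FouriersLaw.Theorems.HonestZwanzig.Robin

end
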